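import Literature.AnabelianGeometry.SemiGraphs.PSCGraphicity
import Mathlib.Topology.Algebra.ContinuousMonoidHom

/-!
# Totally ramified coverings and the numerical criteria ([CombGC] Def. 1.4 (v)(vi), Rmks. 1.4.2–1.4.4; [IUTchI] Rmk. 1.2.3)

Mochizuki, *A combinatorial version of the Grothendieck conjecture*, Tohoku Math. J. **59** (2007)
[CombGC], §1, author's manuscript pp. 11–12: Definition 1.4 (v) ((cuspidally / nodally /
verticially) (purely) totally ramified Galois coverings), Definition 1.4 (vi) ("descends to"),
Remark 1.4.2 (the numerical criteria `r(G') = deg · (r(G) − 1) + 1`, `i(G') = deg · (i(G) − 1) + 1`),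
Remark 1.4.3 (auxiliary coverings), Remark 1.4.4 (module-wise nodal ⟺ nodally totally ramified;
its 2007 items (i), (ii) are superseded by [IUTchI] Rmk. 1.2.3 (v) and not transcribed — ruling μ) [cite: MochizukiCombGC2007, Def 1.4(v)-(vi), Rmks 1.4.2-1.4.4 pp.11-12]
— together with the AMENDED texts printed in [IUTchI] Remark 1.2.3 (i)–(v), pp. 41–43 ("These
inaccuracies arise in the arguments applied in [CombGC], Definition 1.4, (v), (vi), and [CombGC],
Remarks 1.4.2, 1.4.3, and 1.4.4 … should be modified as follows"): (i) Galois coverings are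
connected; (ii) the cuspidal/nodal "purely" notions and Def. 1.4 (vi) may be deleted; (iii)–(v)
replacement texts for Remarks 1.4.2–1.4.4 (typed here next to the originals, cited with the IUT
claim key per cell policy D-0012).

## Level of the typing

Over the interface `PSCDatum P` (file `PSCFundamentalGroup.lean`) and the origin parameter
`Ω : PSCOrigin` (file `PSCGraphicity.lean`): a covering `G' → G''` between two
`Π_G`-coverings of `G` is a pair of open subgroups `H' ≤ H''`, "Galois" = `H'` normal in `H''`; the
cusps of `G''` over the cusp `c` of `G` are the double cosets `H'' γ Π_c`, with cuspidal subgroup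
`H'' ⊓ γΠ_cγ⁻¹ ≤ Π_{G''} = H''`; "`G' → G''` restricts to a connected (resp. trivial) covering over
`(G'')_e`" is `(H'' ⊓ γΠ_eγ⁻¹) · H' = H''` (resp. `H'' ⊓ γΠ_eγ⁻¹ ≤ H'`).  The "one verifies
immediately" CLAIMS of the Remarks are typed (a) as PREDICATES on `G` ("`G` satisfies the claim";
they are statements about genuine semi-graphs of anabelioids of PSC-type, false for junk data) and
(b) as the printed universally quantified statements `…Holds Ω` over the origin predicate
`Ω.IsOfPSCType G` (cell ruling abc-iut-L3-lead 2026-08-25T18:14:50Z); nothing is asserted.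
Equalities of counts involving `r(G) − 1` are written in `ℤ`.  "Isomorphic to `ℤ_l`" ([IUTchI]
Rmk. 1.2.3 (iv), (v)) is recorded as: closed, topologically generated by one element, infinite.
Of the amended Remark 1.4.3 both halves are typed: the cuspidal characterization, and the verticial
half through the inverse images in `Π_G` of `M^unr_G[v] ⊆ M^unr_G` (split injection
`⊕_v M^unr_G[v] ↪ M^unr_G` = independence + closed complement; the criterion for elementary abelian
quotients; the final sentence "the set of vertices … as the set of nontrivial quotients
`M^unr-vert_G ↠ M^unr_G[v] ⊗ F_l`" is their conjunction and gets no separate decl).  Companion file `PSCGraphicity.lean`: Prop. 1.2, Def. 1.4 (i)–(iv), Prop. 1.5, Thm. 1.6.  No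
statement is strengthened; nothing here takes a side on [IUTchIII] Cor. 3.12.
-/

noncomputable section

namespace Literature.AnabelianGeometry.SemiGraphs

namespace PSCDatum

open scoped Pointwise

universe u

variable {P : Type u} [Group P] [TopologicalSpace P] [IsTopologicalGroup P]

/-! ### Galois and cyclic coverings between coverings -/

/-- A *Galois* finite étale covering `G' → G''` between two `Π_G`-coverings of `G` (open subgroups
`H' ≤ H''`), "Galois" understood as connected ([IUTchI] Rmk. 1.2.3 (i), p. 41): `H'` is a normal
subgroup of `H''`. [cite: MochizukiCombGC2007, Def 1.4(v) p.11] -/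
def IsGaloisCovering (H'' H' : Subgroup P) : Prop :=
  H' ≤ H'' ∧ IsOpen (H' : Set P) ∧ IsOpen (H'' : Set P) ∧ (H'.subgroupOf H'').Normal

/-- A *cyclic* covering `G' → G''`: Galois with cyclic Galois group `H''/H'` (recorded as: `H''` is
generated by `H'` and one element). [cite: MochizukiCombGC2007, Def 1.1(ii) p.7] -/
def IsCyclicCovering (H'' H' : Subgroup P) : Prop :=
  IsGaloisCovering H'' H' ∧ ∃ g ∈ H'', H' ⊔ Subgroup.zpowers g = H''

/-! #### Definition 1.4 (v), (vi): (purely) totally ramified coverings; descent -/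

/-- **[CombGC] Definition 1.4 (v)**, p. 11: the Galois covering `G' → G''` (`H' ⊴ H''`) is
*cuspidally totally ramified* if "there exists a cusp `e` of `G''` such that `G' → G''` restricts to
a connected covering over `(G'')_e`". [cite: MochizukiCombGC2007, Def 1.4(v) p.11] -/
def IsCuspidallyTotallyRamified (G : PSCDatum P) (H'' H' : Subgroup P) : Prop :=
  IsGaloisCovering H'' H' ∧ ∃ (c : G.graph.C) (γ : ConjAct P), (H'' ⊓ γ • G.cuspGp c) ⊔ H' = H''

/-- **[CombGC] Definition 1.4 (v)**, p. 11: *nodally totally ramified* (same with a node).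
[cite: MochizukiCombGC2007, Def 1.4(v) p.11] -/
def IsNodallyTotallyRamified (G : PSCDatum P) (H'' H' : Subgroup P) : Prop :=
  IsGaloisCovering H'' H' ∧ ∃ (e : G.graph.N) (γ : ConjAct P), (H'' ⊓ γ • G.nodeGp e) ⊔ H' = H''

/-- **[CombGC] Definition 1.4 (v)**, p. 11: *verticially totally ramified* (same with a vertex).
[cite: MochizukiCombGC2007, Def 1.4(v) p.11] -/
def IsVerticiallyTotallyRamified (G : PSCDatum P) (H'' H' : Subgroup P) : Prop :=
  IsGaloisCovering H'' H' ∧ ∃ (v : G.graph.V) (γ : ConjAct P), (H'' ⊓ γ • G.vertGp v) ⊔ H' = H''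

/-- **[CombGC] Definition 1.4 (v)**, p. 11: `G' → G''` is *cuspidally purely totally ramified* if
there is a cusp `e` of `G''` such that `G' → G''` "restricts to a trivial covering over `(G'')_{e'}`
for all cusps `e' ≠ e` and to a connected covering over `(G'')_e`".  ([IUTchI] Rmk. 1.2.3 (ii),
p. 41: "the cuspidal and nodal cases of the notion of a purely totally ramified covering are in fact
unnecessary and may be deleted" — typed here because [CombGC] Rmks. 1.4.2, 1.4.3 use them.)
[cite: MochizukiCombGC2007, Def 1.4(v) p.11] -/
def IsCuspidallyPurelyTotallyRamified (G : PSCDatum P) (H'' H' : Subgroup P) : Prop :=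
  IsGaloisCovering H'' H' ∧ ∃ (c : G.graph.C) (γ : ConjAct P),
    (H'' ⊓ γ • G.cuspGp c) ⊔ H' = H'' ∧
    ∀ (c' : G.graph.C) (γ' : ConjAct P),
      (c' ≠ c ∨ ConjAct.ofConjAct γ' ∉
          DoubleCoset.doubleCoset (ConjAct.ofConjAct γ) (H'' : Set P) (G.cuspGp c : Set P)) →
      H'' ⊓ γ' • G.cuspGp c' ≤ H'

/-- **[CombGC] Definition 1.4 (v)**, p. 11: *nodally purely totally ramified*.
[cite: MochizukiCombGC2007, Def 1.4(v) p.11] -/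
def IsNodallyPurelyTotallyRamified (G : PSCDatum P) (H'' H' : Subgroup P) : Prop :=
  IsGaloisCovering H'' H' ∧ ∃ (e : G.graph.N) (γ : ConjAct P),
    (H'' ⊓ γ • G.nodeGp e) ⊔ H' = H'' ∧
    ∀ (e' : G.graph.N) (γ' : ConjAct P),
      (e' ≠ e ∨ ConjAct.ofConjAct γ' ∉
          DoubleCoset.doubleCoset (ConjAct.ofConjAct γ) (H'' : Set P) (G.nodeGp e : Set P)) →
      H'' ⊓ γ' • G.nodeGp e' ≤ H'

/-- **[CombGC] Definition 1.4 (v)**, p. 11: *verticially purely totally ramified*.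
[cite: MochizukiCombGC2007, Def 1.4(v) p.11] -/
def IsVerticiallyPurelyTotallyRamified (G : PSCDatum P) (H'' H' : Subgroup P) : Prop :=
  IsGaloisCovering H'' H' ∧ ∃ (v : G.graph.V) (γ : ConjAct P),
    (H'' ⊓ γ • G.vertGp v) ⊔ H' = H'' ∧
    ∀ (v' : G.graph.V) (γ' : ConjAct P),
      (v' ≠ v ∨ ConjAct.ofConjAct γ' ∉
          DoubleCoset.doubleCoset (ConjAct.ofConjAct γ) (H'' : Set P) (G.vertGp v : Set P)) →
      H'' ⊓ γ' • G.vertGp v' ≤ H'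

/-- **[CombGC] Definition 1.4 (vi)**, p. 11: for a closed subgroup `A ⊆ Π_G` and an open subgroup
`A' ⊆ A`, "the inclusion `A' ⊆ A` descends to a finite étale covering `G' → G''`" if
`Π_{G'} ⊆ Π_{G''} ⊆ Π_G` satisfy `A ⊆ Π_{G''}`, `A ∩ Π_{G'} = A'`, `[A : A'] = [Π_{G''} : Π_{G'}]`
(same wording with `Π^unr` for subgroups containing `Ker(Π_G ↠ Π^unr_G)`).  ([IUTchI] Rmk. 1.2.3
(ii): this terminology "is unnecessary and may be deleted" in the amended argument.)
[cite: MochizukiCombGC2007, Def 1.4(vi) p.11] -/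
def Descends (A A' H'' H' : Subgroup P) : Prop :=
  H' ≤ H'' ∧ IsOpen (H' : Set P) ∧ IsOpen (H'' : Set P) ∧ A ≤ H'' ∧ A ⊓ H' = A' ∧
    A'.relIndex A = H'.relIndex H''

/-! ### Remarks 1.4.2 – 1.4.4 (p. 11–12) and their [IUTchI] Rmk. 1.2.3 replacements (pp. 41–43) -/

/-- **[CombGC] Remark 1.4.2**, p. 11, first claim (as printed in [CombGC]): for a Galois covering
`G' → G` of degree a power of `l`, `G` of pro-Σ PSC-type with `Σ = {l}`, "`G' → G` is cuspidally
purely totally ramified if and only if `r(G') = deg(G'/G) · (r(G) − 1) + 1`" (in `ℤ`), for a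
POSITIVE power of `l` (the author's own correction "degree a positive power of `l`", [IUTchI]
Rmk. 1.2.3 (iii); at degree `1` the printed iff fails for noncuspidal `G` — audit A-L3t4-P1, ruling
μ).  [IUTchI] Rmk. 1.2.3 (iii) replaces this text (`CyclicCuspidallyTotallyRamifiedIff`).
[cite: MochizukiCombGC2007, Rmk 1.4.2 p.11] -/
def CuspidalPureRamificationCount (G : PSCDatum P) : Prop :=
  ∀ (l k : ℕ) (H' : Subgroup P), G.Sigma = {l} → 0 < k → H'.Normal → IsOpen (H' : Set P) →
    H'.index = l ^ k →
    (G.IsCuspidallyPurelyTotallyRamified ⊤ H' ↔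
      (G.cuspCount H' : ℤ) = (H'.index : ℤ) * ((G.graph.r : ℤ) - 1) + 1)

/-- **[CombGC] Remark 1.4.2**, p. 11, second claim: "if `G' → G` is a finite étale
`Π^unr_G`-covering [so `n(G') = n(G) · deg(G'/G)`], then `G' → G` is verticially purely totally
ramified if and only if `i(G') = deg(G'/G) · (i(G) − 1) + 1`" (kept verbatim in [IUTchI] Rmk. 1.2.3
(iii) for not necessarily cyclic `Π^unr_G`-coverings, under that text's standing hypothesis "a
Galois finite étale covering of degree a POSITIVE power of `l`", [IUTchI] p. 41 — hence `0 < k`;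
at degree `1` the iff as typed fails exactly for the non-geometric datum with empty underlying
semi-graph, audit A-L3t4-S1). [cite: MochizukiCombGC2007, Rmk 1.4.2 p.11] -/
def VerticialPureRamificationCount (G : PSCDatum P) : Prop :=
  ∀ (l k : ℕ) (H' : Subgroup P), G.Sigma = {l} → 0 < k → H'.Normal → IsOpen (H' : Set P) →
    H'.index = l ^ k → G.IsUnrCovering H' →
    (G.nodeCount H' = G.graph.n * H'.index ∧
      (G.IsVerticiallyPurelyTotallyRamified ⊤ H' ↔
        (G.vertCount H' : ℤ) = (H'.index : ℤ) * ((G.graph.i : ℤ) - 1) + 1))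

/-- **[CombGC] Remark 1.4.2**, p. 11, third claim: "this last equality is equivalent to …
`i(G') − n(G') = deg(G'/G) · (i(G) − n(G) − 1) + 1`".
[cite: MochizukiCombGC2007, Rmk 1.4.2 p.11] -/
def VerticialMinusNodalCount (G : PSCDatum P) : Prop :=
  ∀ (l k : ℕ) (H' : Subgroup P), G.Sigma = {l} → H'.Normal → IsOpen (H' : Set P) →
    H'.index = l ^ k → G.IsUnrCovering H' →
    ((G.vertCount H' : ℤ) = (H'.index : ℤ) * ((G.graph.i : ℤ) - 1) + 1 ↔
      (G.vertCount H' : ℤ) - G.nodeCount H' =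
        (H'.index : ℤ) * ((G.graph.i : ℤ) - G.graph.n - 1) + 1)

/-- **[IUTchI] Remark 1.2.3 (iii)**, p. 41 (replacement text for [CombGC] Rmk. 1.4.2, first part):
"Let `G' → G` be a Galois finite étale covering of degree a positive power of `l`, where `G` is of
pro-Σ PSC-type, `Σ = {l}` … if … the covering `G' → G` is cyclic, then `G' → G` is cuspidally
totally ramified if and only if the inequality `r(G'') < l · r(G)` — where we write `G' → G'' → G`
for the unique [up to isomorphism] factorization … such that `G'' → G` is of degree `l` — is
satisfied."  Claim key of the IUT papers (D-0012).
[cite: Mochizuki2012, IUTchI Rmk 1.2.3(iii) p.41] -/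
def CyclicCuspidallyTotallyRamifiedIff (G : PSCDatum P) : Prop :=
  ∀ (l k : ℕ) (H' : Subgroup P), G.Sigma = {l} → 0 < k → IsCyclicCovering ⊤ H' →
    H'.index = l ^ k →
    (G.IsCuspidallyTotallyRamified ⊤ H' ↔
      ∀ H'' : Subgroup P, H' ≤ H'' → H''.index = l → G.cuspCount H'' < l * G.graph.r)

/-- **[CombGC] Remark 1.4.3**, p. 12 (as printed in [CombGC]): for `G' → G` as in Rmk. 1.4.2 which
is a cuspidally (resp. nodally; verticially) totally ramified `Π_G`- (resp. `Π_G`-; `Π^unr_G`-)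
covering, `G` arbitrary (resp. arbitrary; sturdy), and `e` a cusp (resp. node; vertex) over which
`G' → G` is connected: "There exists a finite étale `Π_G`- (resp. `Π_G`-; `Π^unr_G`-) covering
`G'' → G` such that: (a) `G'' → G` is trivial over `G_e`; (b) the subcovering `G''' → G''` of the
composite covering `G''' → G` of `G'' → G` and `G' → G` is cuspidally (resp. nodally; verticially)
purely totally ramified."  Cuspidal case. [cite: MochizukiCombGC2007, Rmk 1.4.3 p.12] -/
def CuspidalAuxiliaryCoveringExists (G : PSCDatum P) : Prop :=
  ∀ (l k : ℕ) (H' : Subgroup P) (c : G.graph.C) (γ : ConjAct P), G.Sigma = {l} → H'.Normal →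
    IsOpen (H' : Set P) → H'.index = l ^ k → γ • G.cuspGp c ⊔ H' = ⊤ →
    ∃ H'' : Subgroup P, IsOpen (H'' : Set P) ∧
      Subgroup.normalClosure ((γ • G.cuspGp c : Subgroup P) : Set P) ≤ H'' ∧
      G.IsCuspidallyPurelyTotallyRamified H'' (H'' ⊓ H')

/-- **[CombGC] Remark 1.4.3**, p. 12, nodal case. [cite: MochizukiCombGC2007, Rmk 1.4.3 p.12] -/
def NodalAuxiliaryCoveringExists (G : PSCDatum P) : Prop :=
  ∀ (l k : ℕ) (H' : Subgroup P) (e : G.graph.N) (γ : ConjAct P), G.Sigma = {l} → H'.Normal →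
    IsOpen (H' : Set P) → H'.index = l ^ k → γ • G.nodeGp e ⊔ H' = ⊤ →
    ∃ H'' : Subgroup P, IsOpen (H'' : Set P) ∧
      Subgroup.normalClosure ((γ • G.nodeGp e : Subgroup P) : Set P) ≤ H'' ∧
      G.IsNodallyPurelyTotallyRamified H'' (H'' ⊓ H')

/-- **[CombGC] Remark 1.4.3**, p. 12, verticial case (`G` sturdy, `Π^unr_G`-coverings).
[cite: MochizukiCombGC2007, Rmk 1.4.3 p.12] -/
def VerticialAuxiliaryCoveringExists (G : PSCDatum P) : Prop :=
  G.IsSturdy → ∀ (l k : ℕ) (H' : Subgroup P) (v : G.graph.V) (γ : ConjAct P), G.Sigma = {l} →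
    H'.Normal → IsOpen (H' : Set P) → H'.index = l ^ k → G.IsUnrCovering H' →
    γ • G.vertGp v ⊔ H' = ⊤ →
    ∃ H'' : Subgroup P, IsOpen (H'' : Set P) ∧ G.IsUnrCovering H'' ∧
      Subgroup.normalClosure ((γ • G.vertGp v : Subgroup P) : Set P) ≤ H'' ∧
      G.IsVerticiallyPurelyTotallyRamified H'' (H'' ⊓ H')

/-- **[IUTchI] Remark 1.2.3 (iv)**, pp. 41–42 (replacement text for [CombGC] Rmk. 1.4.3), cuspidal
part: for `G` of pro-Σ PSC-type, `Σ = {l}`, "the cuspidal edge-like subgroups of `Π_G` may be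
characterized as the maximal closed subgroups `A ⊆ Π_G` isomorphic to `ℤ_l` which satisfy the
following condition: for every characteristic open subgroup `Π_{G'} ⊆ Π_G`, if we write
`G' → G'' → G` for the finite étale coverings corresponding to `Π_{G'} ⊆ Π_{G''} := A · Π_{G'} ⊆ Π_G`,
then the cyclic finite étale covering `G' → G''` is cuspidally totally ramified."  "Isomorphic to
`ℤ_l`" is recorded as: topologically generated by one element and infinite.  Claim key of the IUT
papers (D-0012); the verticial half of Rmk. 1.2.3 (iv) follows below (`UnrVerticialSplitInjection`,
`ElementaryQuotientVerticiallyRamifiedIff`). [cite: Mochizuki2012, IUTchI Rmk 1.2.3(iv) pp.41-42] -/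
def CuspidalEdgeLikeCharacterization (G : PSCDatum P) : Prop :=
  ∀ l : ℕ, G.Sigma = {l} →
    let cond : Subgroup P → Prop := fun A =>
      IsClosed (A : Set P) ∧ (∃ a : P, (Subgroup.zpowers a).topologicalClosure = A) ∧
        (A : Set P).Infinite ∧
        ∀ U : Subgroup P, U.Characteristic → IsOpen (U : Set P) →
          G.IsCuspidallyTotallyRamified (A ⊔ U) U
    ∀ A : Subgroup P, G.IsCuspidal A ↔ (cond A ∧ ∀ B : Subgroup P, cond B → A ≤ B → A = B)

/-- `E^unr_G`: the inverse image in `Π_G` of `0 ⊆ M^unr_G`, where `M^unr_G` is the abelianization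
of `Π^unr_G` ([IUTchI] Rmk. 1.2.3 (iv), p. 42: "Write `M^unr_G` for the abelianization of `Π^unr_G`"):
the closed subgroup generated by `[Π_G, Π_G]` and `Ker(Π_G ↠ Π^unr_G)`.
[cite: Mochizuki2012, IUTchI Rmk 1.2.3(iv) p.42] -/
def unrAbKer (G : PSCDatum P) : Subgroup P := (⁅(⊤ : Subgroup P), ⊤⁆ ⊔ G.unrKer).topologicalClosure

/-- The inverse image in `Π_G` of `M^unr_G[v] ⊆ M^unr_G`, "the image of the `Π^unr_G`-conjugacy class
of unramified verticial subgroups of `Π^unr_G` associated to `v`" ([IUTchI] Rmk. 1.2.3 (iv), p. 42).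
[cite: Mochizuki2012, IUTchI Rmk 1.2.3(iv) p.42] -/
def unrVertAbOf (G : PSCDatum P) (v : G.graph.V) : Subgroup P := (G.vertGp v ⊔ G.unrAbKer).topologicalClosure

/-- **[IUTchI] Remark 1.2.3 (iv)**, p. 42 (replacement text for [CombGC] Rmk. 1.4.3), verticial part,
first claim, for sturdy `G`: "the inclusions `M^unr_G[v] ⊆ M^unr_G` determine a split injection
`⊕_v M^unr_G[v] ↪ M^unr_G`" — the submodules `M^unr_G[v]` are independent and their sum
`M^unr-vert_G` admits a closed complement.  Claim key of the IUT papers (D-0012).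
[cite: Mochizuki2012, IUTchI Rmk 1.2.3(iv) p.42] -/
def UnrVerticialSplitInjection (G : PSCDatum P) : Prop :=
  G.IsSturdy →
    (∀ v : G.graph.V,
      G.unrVertAbOf v ⊓ (⨆ w : {w : G.graph.V // w ≠ v}, G.unrVertAbOf w.1).topologicalClosure =
        G.unrAbKer) ∧
    ∃ C : Subgroup P, IsClosed (C : Set P) ∧ G.unrAbKer ≤ C ∧
      C ⊓ (⨆ v : G.graph.V, G.unrVertAbOf v).topologicalClosure = G.unrAbKer ∧
      C ⊔ (⨆ v : G.graph.V, G.unrVertAbOf v).topologicalClosure = ⊤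

/-- **[IUTchI] Remark 1.2.3 (iv)**, p. 42, verticial part, second claim, for sturdy `G` of pro-Σ
PSC-type, `Σ = {l}`: an elementary abelian quotient `φ : M^unr_G ↠ Q` "corresponds to a verticially
purely totally ramified covering of `G` if and only if there exists a vertex `v` of `G` such that
`φ(M^unr_G[v]) = Q`, `φ(M^unr_G[v']) = 0` for all vertices `v' ≠ v` of `G`" (the quotient recorded by
its kernel `H' ⊇ E^unr_G`, an open normal subgroup with `Π_G/H'` an elementary abelian `l`-group).
The resulting description of the set of vertices as "the set of [nontrivial!] quotients
`M^unr-vert_G ↠ M^unr_G[v] ⊗ F_l`" is the conjunction of this claim with the split injection.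
Claim key of the IUT papers (D-0012). [cite: Mochizuki2012, IUTchI Rmk 1.2.3(iv) p.42] -/
def ElementaryQuotientVerticiallyRamifiedIff (G : PSCDatum P) : Prop :=
  G.IsSturdy → ∀ (l : ℕ) (H' : Subgroup P), G.Sigma = {l} → H'.Normal → IsOpen (H' : Set P) →
    G.unrAbKer ≤ H' → (∀ g : P, g ^ l ∈ H') →
    (G.IsVerticiallyPurelyTotallyRamified ⊤ H' ↔
      ∃ v : G.graph.V, G.vertGp v ⊔ H' = ⊤ ∧ ∀ v' : G.graph.V, v' ≠ v → G.vertGp v' ≤ H')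

/-- **[CombGC] Remark 1.4.4**, p. 12, first claim (as printed in [CombGC]): for `G' → G` as in
Rmk. 1.4.2 (degree a POSITIVE power of `l`: audit A-L3t4-P3, ruling μ), cyclic, with `G`
noncuspidal, "`G' → G` is module-wise nodal if and only if it is nodally totally ramified".  The
further items (i), (ii) of Remark 1.4.4 as printed in 2007 (characterization of nodal edge-like
subgroups through "descends to a module-wise nodal covering") are SUPERSEDED by the author's
replacement text [IUTchI] Rmk. 1.2.3 (v) (`NodalEdgeLikeCharacterization` below) and are not
transcribed (as typed they would hold vacuously at `B = ⊥`; ruling μ-P4, precedent A7-F1).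
[cite: MochizukiCombGC2007, Rmk 1.4.4 p.12] -/
def ModulewiseNodalIffNodallyTotallyRamified (G : PSCDatum P) : Prop :=
  G.graph.IsNoncuspidal → ∀ (l k : ℕ) (H' : Subgroup P), G.Sigma = {l} → 0 < k →
    IsCyclicCovering ⊤ H' → H'.index = l ^ k →
    (G.IsModulewiseNodal ⊤ H' ↔ G.IsNodallyTotallyRamified ⊤ H')

/-- **[IUTchI] Remark 1.2.3 (v)**, p. 43 (replacement text for [CombGC] Rmk. 1.4.4): for `G` of
pro-Σ PSC-type, `Σ = {l}`, noncuspidal, "the nodal edge-like subgroups of `Π_G` may be characterized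
as the maximal closed subgroups `A ⊆ Π_G` isomorphic to `ℤ_l` which satisfy the following condition:
for every characteristic open subgroup `Π_{G'} ⊆ Π_G`, … `Π_{G''} := A · Π_{G'}` …, the cyclic
finite étale covering `G' → G''` is nodally totally ramified.  Here, we note further that the
finite étale covering `G' → G''` is nodally totally ramified if and only if it is module-wise
nodal" (the latter stated for every closed `A ≅ ℤ_l` and every characteristic open `U`, not only
under the full condition — audit A-L3t4-P2, ruling μ — for `Π_{G'} = U` of finite index in `Π_G`
[automatic for an open subgroup of the profinite group `Π_G` of the text; explicit over the
interface] and for the cyclic covering `G' → G''` NONTRIVIAL, i.e. `A ⊄ U`: at degree `1` the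
printed iff fails for nonnodal `G`, the trivial covering being module-wise nodal but not nodally
totally ramified — audit A-L3t4-S2; in this form the second conjunct is proved for all data in
the companion proof file).  Claim key of the IUT papers (D-0012).
[cite: Mochizuki2012, IUTchI Rmk 1.2.3(v) p.43] -/
def NodalEdgeLikeCharacterization (G : PSCDatum P) : Prop :=
  G.graph.IsNoncuspidal → ∀ l : ℕ, G.Sigma = {l} →
    let cond : Subgroup P → Prop := fun A =>
      IsClosed (A : Set P) ∧ (∃ a : P, (Subgroup.zpowers a).topologicalClosure = A) ∧
        (A : Set P).Infinite ∧
        ∀ U : Subgroup P, U.Characteristic → IsOpen (U : Set P) →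
          G.IsNodallyTotallyRamified (A ⊔ U) U
    (∀ A : Subgroup P, G.IsNodal A ↔ (cond A ∧ ∀ B : Subgroup P, cond B → A ≤ B → A = B)) ∧
    ∀ (A U : Subgroup P), IsClosed (A : Set P) → (∃ a : P, (Subgroup.zpowers a).topologicalClosure = A) →
      (A : Set P).Infinite → U.Characteristic → IsOpen (U : Set P) → U.FiniteIndex → ¬ A ≤ U →
      (G.IsNodallyTotallyRamified (A ⊔ U) U ↔ G.IsModulewiseNodal (A ⊔ U) U)

/-! ### The printed statements over the origin predicate (`…Holds Ω`) -/

section Statements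

/-- **[CombGC] Remark 1.4.2** (p. 11), as printed in [CombGC], for every `G` of PSC-type: the
three numerical claims. [cite: MochizukiCombGC2007, Rmk 1.4.2 p.11] -/
def RamificationCountsHold (Ω : PSCOrigin.{u}) : Prop :=
  ∀ ⦃Q : Type u⦄ [Group Q] [TopologicalSpace Q] [IsTopologicalGroup Q] (G : PSCDatum Q),
    Ω.IsOfPSCType G →
      G.CuspidalPureRamificationCount ∧ G.VerticialPureRamificationCount ∧ G.VerticialMinusNodalCount

/-- **[IUTchI] Remark 1.2.3 (iii)** (p. 41; replacement text of [CombGC] Rmk. 1.4.2), for every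
`G` of PSC-type: its three displays — the cyclic cuspidal criterion `r(G'') < l · r(G)`, the
verticial count `i(G') = deg(G'/G) · (i(G) − 1) + 1`, and the equivalent form with
`i(…) − n(…)` (third display, p. 41; audit E5-F3).  Claim key of the IUT papers (D-0012).
[cite: Mochizuki2012, IUTchI Rmk 1.2.3(iii) p.41] -/
def CyclicCuspidallyTotallyRamifiedIffHolds (Ω : PSCOrigin.{u}) : Prop :=
  ∀ ⦃Q : Type u⦄ [Group Q] [TopologicalSpace Q] [IsTopologicalGroup Q] (G : PSCDatum Q),
    Ω.IsOfPSCType G → G.CyclicCuspidallyTotallyRamifiedIff ∧ G.VerticialPureRamificationCount ∧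
      G.VerticialMinusNodalCount

/-- **[CombGC] Remark 1.4.3** (p. 12), as printed in [CombGC], for every `G` of PSC-type: the
auxiliary coverings exist (cuspidal, nodal, and — for `G` sturdy — verticial cases).
[cite: MochizukiCombGC2007, Rmk 1.4.3 p.12] -/
def AuxiliaryCoveringsExistHolds (Ω : PSCOrigin.{u}) : Prop :=
  ∀ ⦃Q : Type u⦄ [Group Q] [TopologicalSpace Q] [IsTopologicalGroup Q] (G : PSCDatum Q),
    Ω.IsOfPSCType G → G.CuspidalAuxiliaryCoveringExists ∧ G.NodalAuxiliaryCoveringExists ∧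
      G.VerticialAuxiliaryCoveringExists

/-- **[IUTchI] Remark 1.2.3 (iv)** (pp. 41–42; replacement text of [CombGC] Rmk. 1.4.3), cuspidal
part, for every `G` of PSC-type.  Claim key of the IUT papers (D-0012).
[cite: Mochizuki2012, IUTchI Rmk 1.2.3(iv) pp.41-42] -/
def CuspidalEdgeLikeCharacterizationHolds (Ω : PSCOrigin.{u}) : Prop :=
  ∀ ⦃Q : Type u⦄ [Group Q] [TopologicalSpace Q] [IsTopologicalGroup Q] (G : PSCDatum Q),
    Ω.IsOfPSCType G → G.CuspidalEdgeLikeCharacterization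

/-- **[IUTchI] Remark 1.2.3 (iv)** (p. 42), verticial part, for every sturdy `G` of PSC-type: the
split injection `⊕_v M^unr_G[v] ↪ M^unr_G` and the criterion for elementary abelian quotients.
Claim key of the IUT papers (D-0012). [cite: Mochizuki2012, IUTchI Rmk 1.2.3(iv) p.42] -/
def UnrVerticialCharacterizationHolds (Ω : PSCOrigin.{u}) : Prop :=
  ∀ ⦃Q : Type u⦄ [Group Q] [TopologicalSpace Q] [IsTopologicalGroup Q] (G : PSCDatum Q),
    Ω.IsOfPSCType G → G.UnrVerticialSplitInjection ∧ G.ElementaryQuotientVerticiallyRamifiedIff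

/-- **[CombGC] Remark 1.4.4**, first claim (p. 12), as printed in [CombGC], for every noncuspidal
`G` of PSC-type ((i), (ii) of the 2007 text are superseded by [IUTchI] Rmk. 1.2.3 (v) and not
transcribed — ruling μ-P4). [cite: MochizukiCombGC2007, Rmk 1.4.4 p.12] -/
def ModulewiseNodalRemarkHolds (Ω : PSCOrigin.{u}) : Prop :=
  ∀ ⦃Q : Type u⦄ [Group Q] [TopologicalSpace Q] [IsTopologicalGroup Q] (G : PSCDatum Q),
    Ω.IsOfPSCType G → G.ModulewiseNodalIffNodallyTotallyRamified

/-- **[IUTchI] Remark 1.2.3 (v)** (p. 43; replacement text of [CombGC] Rmk. 1.4.4), for every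
noncuspidal `G` of PSC-type.  Claim key of the IUT papers (D-0012).
[cite: Mochizuki2012, IUTchI Rmk 1.2.3(v) p.43] -/
def NodalEdgeLikeCharacterizationHolds (Ω : PSCOrigin.{u}) : Prop :=
  ∀ ⦃Q : Type u⦄ [Group Q] [TopologicalSpace Q] [IsTopologicalGroup Q] (G : PSCDatum Q),
    Ω.IsOfPSCType G → G.NodalEdgeLikeCharacterization

end Statements

end PSCDatum

end Literature.AnabelianGeometry.SemiGraphs

end
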